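import Summits.FinalStateConjecture.FinalStateConjecture.Theorems.ZeroEnergyKerrOrBombStationaryLimitReductionKerrIsometryRigidityWave3Facts
import Summits.FinalStateConjecture.FinalStateConjecture.Theorems.ZeroEnergyKerrOrBombStationaryLimitReductionTimeEquivariantMaps
import Summits.FinalStateConjecture.FinalStateConjecture.Theorems.ZeroEnergyKerrOrBombStationaryLimitReductionChartReadaptation
import Literature.Geometry.Lorentzian.KerrSchildDecay
import Literature.Geometry.Lorentzian.KerrSchildDerivativeDecay
import Literature.Geometry.Lorentzian.CoordSlice
import Literature.Geometry.Lorentzian.MultiCentreKerrSchild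
import Literature.Geometry.Lorentzian.KerrWaveEnergy
import Literature.Geometry.Lorentzian.KerrSchildEnergyEstimate
import HarnessLib

/-!
# Route ZeroEnergyKerrOrBomb · crux `FinalStateFromKerrOrBomb` (stmt-FinalStateConjecture-17839), line
# `SketchIdeator1` — stub `stub_kerrAsymptoticRigidity` (F4 of stub 1R), layer 5: `D²Θ = O(r⁻²)`

Helper file (`--supports stmt-FinalStateConjecture-17839`; registered helper
`kerrAsymptoticRigidity_iteratedFDeriv_two_decay`) of the lead's wave-2 stub-worker for
`stub_kerrAsymptoticRigidity : SigM.stub_kerrAsymptoticRigidity` (`:= KerrAsymptoticRigidity`, obligation F4 of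
stub 1R, `…KerrIsometryRigidityWave3Facts`). Hypotheses: the binder list of `KerrAsymptoticRigidity` VERBATIM, then
(for chaining) the conclusions of layer 2 (`kerrAsymptoticRigidity_fderiv_bounded`, p137926: two-sided bounds on
`dΘ` on `{r ≥ R}` with constant `L`), layer 3 (`kerrAsymptoticRigidity_iteratedFDeriv_two_le`, p138505:
`‖D²Θ‖ ≤ 2L(‖D g_{M,a}‖ + L³ ‖D A.bilin ∘ Θ‖)` far out) and layer 4 (`kerrAsymptoticRigidity_radius_comparable`,
p138872: `r ≤ C r_A ∘ Θ`, `r_A ∘ Θ ≤ C r` far out). Conclusion: `‖D²Θ(u)‖ ≤ C₅ / r(u)²` far out — the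
integrable decay which makes `dΘ` converge at infinity (Bartnik 1986, Cor. 3.2 with `α = 1`).

* §1 `exists_norm_fderiv_kerr_bilin_le`: `‖D g_{M,a}(x)‖ ≤ C/‖x_{space}‖²` far out, for ALL `M, a` — the slice
  symbol estimate `g_{M,a}(0, ·) − η ∈ O₁(ρ⁻¹)` (`Kerr.isBigOSmooth_bilin_sub_ofTimeSpace`) transported to `E4` by
  stationarity (`Kerr.eq_slice_spatial_of_time_invariant`, chain rule through the spatial projection);
* §2 `exists_norm_fderiv_adaptedChart_bilin_le_sq`: `‖D A.bilin(y)‖ ≤ B/r_A(y)²` far out on `A.domain`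
  (`C²`-Schwarzschildean clause at order `1` plus §1 for `g_{M_A,0}`, `|r_A − ‖·_{space}‖| ≤ C_A`);
* §3 the registered helper.

Elementary; no named fact, nothing restated. References: R. Bartnik, CPAM 39 (1986), §3, (3.5)–(3.6), Cor. 3.2;
P. T. Chruściel, J. L. Costa, arXiv:0806.0016, §2.1; M. Visser, arXiv:0706.0622, (32)–(35).
-/

set_option linter.dupNamespace false

-- instance search through the nested operator types `E4 →L[ℝ] E4 →L[ℝ] ℝ`
set_option maxSynthPendingDepth 3

noncomputable section

open scoped Manifold ContDiff Topology
open Set Filter Function Bornology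

namespace Summit.FinalStateConjecture.FinalStateConjecture.Theorems.SymplecticDualOfTheBomb

open Literature.Geometry.Lorentzian
open Summit.FinalStateConjecture.FinalStateConjecture.Theorems.OneLockedExplosion

/-! ## §1 `D g_{M,a} = O(r⁻²)` on `E4` -/

/-- The spatial projection has operator norm `≤ 1`. [folklore] -/
private theorem norm_spatial_le_one : ‖(E4.spatial : E4 →L[ℝ] E3)‖ ≤ 1 :=
  ContinuousLinearMap.opNorm_le_bound _ zero_le_one fun x ↦ by
    rw [one_mul]; exact E4.spatialNorm_le_norm x

/-- **`‖D g_{M,a}(x)‖ ≤ C / ‖x_{space}‖²` far out**, for all real `M, a`: the slice estimate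
`g_{M,a}(0, ·) − η ∈ O₁(ρ⁻¹)` (`Kerr.isBigOSmooth_bilin_sub_ofTimeSpace`) read at first order, transported to `E4`
by stationarity of the Kerr–Schild components. Visser arXiv:0706.0622, (32)–(35); Cook 2000, §3.2.2
(`∂ g = O(r⁻²)`). [folklore] -/
private theorem exists_norm_fderiv_kerr_bilin_le (M a : ℝ) :
    ∃ C R : ℝ, 0 < R ∧ ∀ x : E4, R ≤ E4.spatialNorm x →
      ‖fderiv ℝ (Kerr.bilin M a) x‖ ≤ C / E4.spatialNorm x ^ 2 := by
  set f : E3 → E4 →L[ℝ] E4 →L[ℝ] ℝ := fun z ↦ Kerr.bilin M a (E4.ofTimeSpace 0 z) - Minkowski.bilin with hf_def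
  have hf : IsBigOSmooth 1 (-1) f := Kerr.isBigOSmooth_bilin_sub_ofTimeSpace M a 1
  obtain ⟨c, hc⟩ := (hf.isBigO (m := 1) le_rfl).bound
  obtain ⟨R₀, hR₀⟩ := exists_radius_of_eventually_cobounded hc
  refine ⟨c, max (max R₀ |a|) 0 + 1, by positivity, fun x hx ↦ ?_⟩
  set z : E3 := E4.spatial x with hz_def
  have hzn : ‖z‖ = E4.spatialNorm x := rfl
  have hz0 : R₀ < ‖z‖ := by
    rw [hzn]; linarith [le_max_left (max R₀ |a|) 0, le_max_left R₀ |a|]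
  have hza : |a| < E4.spatialNorm x := by
    linarith [le_max_left (max R₀ |a|) 0, le_max_right R₀ |a|]
  have hsp0 : 0 < E4.spatialNorm x := (abs_nonneg a).trans_lt hza
  -- differentiability of the slice function at `z`
  have hrad : 0 < Kerr.radius a (E4.ofTimeSpace 0 z) := by
    rw [hz_def, Kerr.radius_ofTimeSpace_spatial]; exact Kerr.radius_pos_of_abs_lt hza
  have hFd : DifferentiableAt ℝ (Kerr.bilin M a) (E4.ofTimeSpace 0 z) :=
    (Kerr.contDiffAt_bilin M a hrad (n := 1)).differentiableAt one_ne_zero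
  set f' : E3 → E4 →L[ℝ] E4 →L[ℝ] ℝ := fun z ↦ Kerr.bilin M a (E4.ofTimeSpace 0 z) with hf'_def
  have hf'd : DifferentiableAt ℝ f' z :=
    hFd.comp z (CoordSlice.hasFDerivAt_ofTimeSpace_zero z).differentiableAt
  -- chain rule through the spatial projection (stationarity)
  have hF : HasFDerivAt (Kerr.bilin M a) ((fderiv ℝ f' z).comp E4.spatial) x := by
    have h := hf'd.hasFDerivAt.comp x E4.spatial.hasFDerivAt
    exact h.congr_of_eventuallyEq (Eventually.of_forall fun y ↦
      Kerr.eq_slice_spatial_of_time_invariant (fun y t ↦ Kerr.bilin_add_smul_basisVector_zero M a y t) y)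
  rw [hF.fderiv]
  -- the slice bound
  have hb := hR₀ z hz0
  have e1 : fderiv ℝ f z = fderiv ℝ f' z := by rw [hf_def]; exact fderiv_sub_const _
  have e2 : ‖iteratedFDeriv ℝ 1 f z‖ = ‖fderiv ℝ f' z‖ := by
    rw [← e1]
    calc ‖iteratedFDeriv ℝ 1 f z‖ = ‖iteratedFDeriv ℝ 0 (fderiv ℝ f) z‖ := norm_iteratedFDeriv_fderiv.symm
      _ = ‖fderiv ℝ f z‖ := norm_iteratedFDeriv_zero
  have e3 : ‖z‖ ^ ((-1 : ℝ) - ((1 : ℕ) : ℝ)) = (‖z‖ ^ 2)⁻¹ := by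
    rw [show ((-1 : ℝ) - ((1 : ℕ) : ℝ)) = -(2 : ℝ) by norm_num, Real.rpow_neg (norm_nonneg _), Real.rpow_two]
  rw [Real.norm_of_nonneg (norm_nonneg _), e2, e3, Real.norm_of_nonneg (by positivity)] at hb
  calc ‖(fderiv ℝ f' z).comp E4.spatial‖ ≤ ‖fderiv ℝ f' z‖ * ‖(E4.spatial : E4 →L[ℝ] E3)‖ :=
        ContinuousLinearMap.opNorm_comp_le _ _
    _ ≤ ‖fderiv ℝ f' z‖ * 1 := by gcongr; exact norm_spatial_le_one
    _ ≤ c * (‖z‖ ^ 2)⁻¹ := by rw [mul_one]; exact hb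
    _ = c / E4.spatialNorm x ^ 2 := by rw [hzn, div_eq_mul_inv]

/-! ## §2 `D(A.bilin) = O(r_A⁻²)` on the chart domain -/

/-- **`‖D A.bilin(y)‖ ≤ B / r_A(y)²` far out on `A.domain`**: `D(A.bilin − g_{M_A,0}) = O(r_A⁻³)` by the `C²`
clause of `ChartIsAsymptoticallySchwarzschildean'`, `D g_{M_A,0} = O(‖y_{space}‖⁻²)` by §1, and
`|r_A − ‖·_{space}‖| ≤ C_A`. [folklore] -/
private theorem exists_norm_fderiv_adaptedChart_bilin_le_sq {𝓑 : StationaryAFBlackHole.{0}} (A : 𝓑.AdaptedChart)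
    (hschw : ChartIsAsymptoticallySchwarzschildean' A) :
    ∃ R₂ B : ℝ, ∀ y ∈ (A.domain : Set E4), R₂ ≤ A.radius y → ‖fderiv ℝ A.bilin y‖ ≤ B / A.radius y ^ 2 := by
  obtain ⟨MA, CA, RA, -, hder⟩ := hschw
  obtain ⟨C₀, R₀, hR₀, hK₀⟩ := exists_norm_fderiv_kerr_bilin_le MA 0
  obtain ⟨D, hD⟩ := A.exists_abs_radius_sub_spatialNorm_le
  refine ⟨max (max RA 1) (2 * (R₀ + |D|)), |CA| + 4 * |C₀|, fun y hy hyR ↦ ?_⟩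
  have hRA : RA ≤ A.radius y := ((le_max_left _ _).trans (le_max_left _ _)).trans hyR
  have h1 : 1 ≤ A.radius y := ((le_max_right _ _).trans (le_max_left _ _)).trans hyR
  have h2 : 2 * (R₀ + |D|) ≤ A.radius y := (le_max_right _ _).trans hyR
  have hDy := hD y
  have hsp : A.radius y / 2 ≤ E4.spatialNorm y := by
    linarith [(abs_le.1 hDy).2, le_abs_self D, hR₀]
  have hsp0 : R₀ ≤ E4.spatialNorm y := by linarith [(abs_le.1 hDy).2, le_abs_self D]
  have hspos : 0 < E4.spatialNorm y := hR₀.trans_le hsp0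
  -- the two pieces
  have hdA : DifferentiableAt ℝ A.bilin y :=
    ((contDiffOn_adaptedChart_bilin A).contDiffAt (A.domain.isOpen.mem_nhds hy)).differentiableAt (by simp)
  have hdK : DifferentiableAt ℝ (Kerr.bilin MA 0) y := by
    refine (Kerr.contDiffAt_bilin MA 0 ?_ (n := 1)).differentiableAt one_ne_zero
    rw [Kerr.radius_zero_left]; exact hspos
  have hpert := hder ⟨y, hy⟩ hRA 1 (by norm_num)
  have e2 : ‖iteratedFDeriv ℝ 1 (fun z ↦ A.bilin z - Kerr.bilin MA 0 z) y‖ =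
      ‖fderiv ℝ (fun z ↦ A.bilin z - Kerr.bilin MA 0 z) y‖ :=
    calc _ = ‖iteratedFDeriv ℝ 0 (fderiv ℝ (fun z ↦ A.bilin z - Kerr.bilin MA 0 z)) y‖ :=
          norm_iteratedFDeriv_fderiv.symm
      _ = _ := norm_iteratedFDeriv_zero
  rw [e2] at hpert
  have hK := hK₀ y hsp0
  have e : fderiv ℝ A.bilin y =
      fderiv ℝ (fun z ↦ A.bilin z - Kerr.bilin MA 0 z) y + fderiv ℝ (Kerr.bilin MA 0) y := by
    rw [fderiv_fun_sub hdA hdK, sub_add_cancel]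
  rw [e, add_div]
  have hrA0 : 0 < A.radius y := one_pos.trans_le h1
  refine (norm_add_le _ _).trans (add_le_add ?_ ?_)
  · refine hpert.trans ?_
    simp only [Nat.reduceAdd]
    calc CA / A.radius y ^ 3 ≤ |CA| / A.radius y ^ 3 := by gcongr; exact le_abs_self _
      _ ≤ |CA| / A.radius y ^ 2 := by
          apply div_le_div_of_nonneg_left (abs_nonneg _) (by positivity)
          nlinarith
  · refine hK.trans ?_
    calc C₀ / E4.spatialNorm y ^ 2 ≤ |C₀| / E4.spatialNorm y ^ 2 := by gcongr; exact le_abs_self _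
      _ ≤ |C₀| / (A.radius y / 2) ^ 2 := by
          apply div_le_div_of_nonneg_left (abs_nonneg _) (by positivity)
          exact pow_le_pow_left₀ (by positivity) hsp 2
      _ = 4 * |C₀| / A.radius y ^ 2 := by field_simp; ring

/-! ## §3 `D²Θ = O(r⁻²)` -/

/-- The Kerr exterior has points of arbitrarily large Kerr–Schild radius. [folklore] -/
private theorem exists_mem_exterior_le_radius (M a K : ℝ) :
    ∃ x ∈ (Kerr.exterior M a : Set E4), K ≤ Kerr.radius a x := by
  set K' : ℝ := max K (max (Kerr.rPlus M a) 0 + 1) with hK'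
  have hK'0 : 0 ≤ K' := le_max_of_le_right (by positivity)
  set y : E3 := EuclideanSpace.single 0 (K' + |a|) with hy
  have hyn : ‖y‖ = K' + |a| := by
    rw [hy, PiLp.norm_single, Real.norm_eq_abs, abs_of_nonneg (by positivity)]
  have h1 := Kerr.spatialNorm_sq_sub_sq_le_radius_sq a (E4.ofTimeSpace 0 y)
  rw [E4.spatialNorm_ofTimeSpace, hyn] at h1
  have h2 : K' ^ 2 ≤ Kerr.radius a (E4.ofTimeSpace 0 y) ^ 2 := by nlinarith [abs_nonneg a, sq_abs a]
  have h3 : K' ≤ Kerr.radius a (E4.ofTimeSpace 0 y) :=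
    (pow_le_pow_iff_left₀ hK'0 (Kerr.radius_nonneg _ _) two_ne_zero).1 h2
  refine ⟨E4.ofTimeSpace 0 y, ?_, (le_max_left _ _).trans h3⟩
  rw [SetLike.mem_coe, Kerr.mem_exterior]
  have : max (Kerr.rPlus M a) 0 + 1 ≤ K' := le_max_right _ _
  linarith

/-- **Registered helper `kerrAsymptoticRigidity_iteratedFDeriv_two_decay`** (layer 5 of F4 = `KerrAsymptoticRigidity`; its binder
list verbatim, followed by the conclusions of layers 2, 3, 4 as hypotheses): `‖D²Θ(u)‖ ≤ C₅ / r(u)²` far out along the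
exterior. From layer 3, `‖D²Θ‖ ≤ 2L (‖D g_{M,a}‖ + L³ ‖D A.bilin ∘ Θ‖)`, with `‖D g_{M,a}‖ ≤ C/‖x_{space}‖² ≤ C/r²`
(§1, `r ≤ ‖x_{space}‖`), `‖D A.bilin‖ ≤ B/r_A²` (§2) and `r ≤ C₄ r_A ∘ Θ` (layer 4). Bartnik 1986, §3, Cor. 3.2
(`∂²y = O(r^{−2−α})`, here against the common Schwarzschild background); Chruściel–Costa arXiv:0806.0016, §2.1. [folklore] -/
theorem kerrAsymptoticRigidity_iteratedFDeriv_two_decay : ∀ (𝓑 : StationaryAFBlackHole.{0}) (A : 𝓑.AdaptedChart) (M a c : ℝ) (Θ : E4 → E4), ChartIsAsymptoticallyCartesian A → ChartIsAsymptoticallySchwarzschildean' A → Kerr.IsSubextremal M a → 0 < c → ContDiffOn ℝ ∞ Θ (Kerr.exterior M a : Set E4) → Set.InjOn Θ (Kerr.exterior M a : Set E4) → Set.MapsTo Θ (Kerr.exterior M a : Set E4) (A.domain : Set E4) → (∀ x ∈ (Kerr.exterior M a : Set E4), ∀ s : ℝ, Θ (x + s • E4.basisVector 0) = Θ x + (c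 * s) • E4.basisVector 0) → (∀ x ∈ (Kerr.exterior M a : Set E4), ∀ v w : E4, A.bilin (Θ x) (fderiv ℝ Θ x v) (fderiv ℝ Θ x w) = Kerr.bilin M a x v w) → Θ '' (Kerr.exterior M a : Set E4) = {u : E4 | ∃ h : u ∈ A.domain, A.toFun ⟨u, h⟩ ∈ 𝓑.doc} → (∀ R₁ : ℝ, ∃ R : ℝ, ∀ x ∈ (Kerr.exterior M a : Set E4), R ≤ Kerr.radius a x → R₁ ≤ A.radius (Θ x)) → ∀ R L : ℝ, (∀ u ∈ (Kerr.exterior M a : Set E4), R ≤ Kerr.radius a u → ‖fderiv ℝ Θ u‖ ≤ L ∧ ∀ v : E4, ‖v‖ ≤ L * ‖fderiv ℝ Θ u v‖) → (∃ R' : ℝ, ∀ u ∈ (Kerr.exterior M a : Set E4), R' ≤ Kerr.radius a u → ‖iteratedFDeriv ℝ 2 Θ u‖ ≤ 2 * L * (‖fderiv ℝ (Kerr.bilin M a) u‖ + L ^ 3 * ‖fderiv ℝ A.bilin (Θ u)‖)) → (∃ R' C : ℝ, ∀ x ∈ (Kerr.exterior M a : Set E4), R' ≤ Kerr.radius a x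 → Kerr.radius a x ≤ C * A.radius (Θ x) ∧ A.radius (Θ x) ≤ C * Kerr.radius a x) → ∃ R₅ C₅ : ℝ, ∀ u ∈ (Kerr.exterior M a : Set E4), R₅ ≤ Kerr.radius a u → ‖iteratedFDeriv ℝ 2 Θ u‖ ≤ C₅ / Kerr.radius a u ^ 2 := by
  intro 𝓑 A M a c Θ _ hschw _ _ _ _ hΘmaps _ _ _ hfar R L hRL h3 h4
  obtain ⟨R₃, hR₃⟩ := h3
  obtain ⟨R₄, C₄, hR₄⟩ := h4
  obtain ⟨CK, RK, _, hK⟩ := exists_norm_fderiv_kerr_bilin_le M a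
  obtain ⟨R₂, B, hB⟩ := exists_norm_fderiv_adaptedChart_bilin_le_sq A hschw
  obtain ⟨R₆, hR₆⟩ := hfar (max R₂ 1)
  have hL0 : 0 ≤ L := by
    obtain ⟨x, hx, hxR⟩ := exists_mem_exterior_le_radius M a R
    exact (norm_nonneg _).trans (hRL x hx hxR).1
  refine ⟨max (max R₃ R₄) (max RK R₆), 2 * L * (|CK| + L ^ 3 * (|B| * C₄ ^ 2)), fun u hu huR ↦ ?_⟩
  have hr : 0 < Kerr.radius a u := Kerr.radius_pos_of_mem_region hu
  have h3u := hR₃ u hu (((le_max_left _ _).trans (le_max_left _ _)).trans huR)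
  have h4u := (hR₄ u hu (((le_max_right _ _).trans (le_max_left _ _)).trans huR)).1
  have hfu := hR₆ u hu (((le_max_right _ _).trans (le_max_right _ _)).trans huR)
  have hrA1 : 1 ≤ A.radius (Θ u) := (le_max_right _ _).trans hfu
  have hrA0 : 0 < A.radius (Θ u) := one_pos.trans_le hrA1
  -- the Kerr side
  have hsp : Kerr.radius a u ≤ E4.spatialNorm u := Kerr.radius_le_spatialNorm a u
  have hKu : ‖fderiv ℝ (Kerr.bilin M a) u‖ ≤ |CK| / Kerr.radius a u ^ 2 := by
    have h := hK u ((((le_max_left _ _).trans (le_max_right _ _)).trans huR).trans hsp)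
    refine h.trans ?_
    calc CK / E4.spatialNorm u ^ 2 ≤ |CK| / E4.spatialNorm u ^ 2 := by gcongr; exact le_abs_self _
      _ ≤ |CK| / Kerr.radius a u ^ 2 := by
          apply div_le_div_of_nonneg_left (abs_nonneg _) (by positivity)
          exact pow_le_pow_left₀ hr.le hsp 2
  -- the `A` side
  have hAu : ‖fderiv ℝ A.bilin (Θ u)‖ ≤ |B| * C₄ ^ 2 / Kerr.radius a u ^ 2 := by
    have h := hB (Θ u) (hΘmaps hu) ((le_max_left _ _).trans hfu)
    refine h.trans ?_
    calc B / A.radius (Θ u) ^ 2 ≤ |B| / A.radius (Θ u) ^ 2 := by gcongr; exact le_abs_self _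
      _ ≤ |B| * C₄ ^ 2 / Kerr.radius a u ^ 2 := by
          rw [div_le_div_iff₀ (by positivity) (by positivity)]
          have : Kerr.radius a u ^ 2 ≤ (C₄ * A.radius (Θ u)) ^ 2 := pow_le_pow_left₀ hr.le h4u 2
          nlinarith [abs_nonneg B]
  refine h3u.trans ?_
  have hL3 : 0 ≤ L ^ 3 := by positivity
  calc 2 * L * (‖fderiv ℝ (Kerr.bilin M a) u‖ + L ^ 3 * ‖fderiv ℝ A.bilin (Θ u)‖)
      ≤ 2 * L * (|CK| / Kerr.radius a u ^ 2 + L ^ 3 * (|B| * C₄ ^ 2 / Kerr.radius a u ^ 2)) := by gcongr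
    _ = 2 * L * (|CK| + L ^ 3 * (|B| * C₄ ^ 2)) / Kerr.radius a u ^ 2 := by
        field_simp

end Summit.FinalStateConjecture.FinalStateConjecture.Theorems.SymplecticDualOfTheBomb

end
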